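import Summits.BirchSwinnertonDyer.Rank1Residual.JET.RingClassTransverseLagrangian
import Summits.BirchSwinnertonDyer.BirchSwinnertonDyer.Theorems.KolyvaginRankRigidityAtTwoTransverseCupEven
import HarnessLib

/-!
# Crux V2♭θ / V2♭∞ (stmt-BirchSwinnertonDyer-27220; line `kolyvagin_depth_split`), stub S1, piece P8 (iso) —
# the ring-class transverse condition at a Kolyvagin prime is LAGRANGIAN at `p = 2` (margin one)

Port of `JET.RingClassTransverse.{weilCupProduct_eq_zero_of_mem_transverseSubgroup_ringClassField,
annRight_invWeilPairing_transverseSubgroup_ringClassField_eq, dualTransported_eq_of_localTransverseFamily}`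
(odd `p`) to `p = 2`: the ONLY use of `p ≠ 2` there is the isotropy (cup products of two transverse classes
vanish) via `TransverseCup.cupProduct_eq_zero_of_principal_of_cyclic` (values killed by an ODD integer); at `2`
the even-order mechanism `TransverseCupEven.cupProduct_eq_zero_of_principal_of_cyclic_even` needs
`binom(ℓ + 1, 2) · μ_{2^k} = 0`, i.e. `2^{k+1} ∣ ℓ + 1`: index `M(ℓ) ≥ k + 1` (MARGIN ONE — the hypothesis
`M + 1 ≤ kolyvaginIndex` carried by the crux V2♭θ / the S1 composition). Everything else is byte-for-byte the
odd-`p` proof. `dualTransported_eq_of_localTransverseFamily_two` is the binder `h𝒯sd` of the S1 composition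
`primeSwapAtTwoLossy_core[_frob]` for the ring-class transverse family. HONEST FRAMING: helper; S1, V2♭θ and
BSD are not proved here.
References: [cite: Howard2004HeegnerKolyvagin, Prop. 2.1.9 (ii)] [cite: MazurRubin2004, Prop. 1.3.2 (ii) (p. 12)]
[cite: Jetchev2008, §3.1.2 (p. 814)] [cite: MilneADT2006, Ch. I, Cor. 2.3, Thm. 2.8].
-/

set_option autoImplicit false
set_option linter.dupNamespace false

noncomputable section

open scoped Classical Pointwise

namespace Summit.BirchSwinnertonDyer.BirchSwinnertonDyer.Theorems.KolyvaginLowerBoundAtTwo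

open CategoryTheory ContinuousCohomology WeierstrassCurve Field Function NumberField IsDedekindDomain
open Literature.NumberTheory.EllipticCurves Literature.NumberTheory.EllipticCurves.Jetchev2008
open Literature.NumberTheory.GaloisRepresentations Literature.NumberTheory.GaloisCohomology
open Literature.NumberTheory.GaloisRepresentations.DiscreteGaloisModule (mu MuCarrier transverseSubgroup SelmerStructure)
open Literature.NumberTheory.Automorphic _root_.TopRep
open Summit.BirchSwinnertonDyer.Rank1Residual.GaloisImage
open Summit.BirchSwinnertonDyer.Rank1Residual.X11b.FiniteDuality
open Summit.BirchSwinnertonDyer.Rank1Residual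
open Summit.BirchSwinnertonDyer.Rank1Residual.JET.RingClassTransverse
open Summit.BirchSwinnertonDyer.Rank1Residual.JET.SelmerVocabulary
open scoped ContRepresentation NumberField

variable (W : WeierstrassCurve ℚ) [W.IsElliptic] [W.IsGloballyMinimal] (K : Type) [Field K] [NumberField K]

/-- **Isotropy of `H¹_tr(K_λ, E[2^k])` at a Kolyvagin prime of index `≥ k + 1`** (even-order mechanism).
[cite: MazurRubin2004, Prop. 1.3.2 (ii) (p. 12)] [cite: Howard2004HeegnerKolyvagin, Prop. 2.1.9 (ii)] -/
theorem weilCupProduct_eq_zero_of_mem_transverseSubgroup_ringClassField_two (hK : IsImaginaryQuadratic K)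
    (hD : NumberField.discr K < -4) (ι : K →+* ℂ) [∀ j : ℕ, NumberField (ringClassField K ι j)]
    (k : ℕ) [NeZero (2 ^ k)]
    {ℓ : ℕ} (hℓ : Zhang2014.IsKolyvaginPrime (W.conductorNorm ℤ) W K 2 ℓ)
    (hkℓ : k + 1 ≤ Zhang2014.kolyvaginIndex W 2 ℓ)
    (v : HeightOneSpectrum (𝓞 K)) (hv : (ℓ : 𝓞 K) ∈ v.asIdeal)
    [CompactSpace (absoluteGaloisGroup (Place.Completion (Sum.inr v : Place K)))]
    (w' : HeightOneSpectrum (𝓞 (ringClassField K ι ℓ))) [w'.asIdeal.LiesOver v.asIdeal]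
    (e : geomTorsion (W.baseChange K) ((2 ^ k : ℕ) : ℤ) → geomTorsion (W.baseChange K) ((2 ^ k : ℕ) : ℤ) →
      AlgebraicClosure K)
    (hμ : ∀ S T, e S T ^ (2 ^ k) = 1)
    (hadd₁ : ∀ S₁ S₂ T, e (S₁ + S₂) T = e S₁ T * e S₂ T)
    (hadd₂ : ∀ S T₁ T₂, e S (T₁ + T₂) = e S T₁ * e S T₂)
    (hgal : ∀ (g : absoluteGaloisGroup K) (S T : geomTorsion (W.baseChange K) ((2 ^ k : ℕ) : ℤ)),
      g • e S T = e (g • S) (g • T))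
    {a b : galoisCohomology (GaloisRep.toLocal v ((W.baseChange K).torsionGaloisModule ((2 ^ k : ℕ) : ℤ))) 1}
    (ha : a ∈ (letI := (adicCompletionOfLiesOver K (ringClassField K ι ℓ) v w').toAlgebra;
      transverseSubgroup (GaloisRep.toLocal v ((W.baseChange K).torsionGaloisModule ((2 ^ k : ℕ) : ℤ)))
        (w'.adicCompletion (ringClassField K ι ℓ))))
    (hb : b ∈ (letI := (adicCompletionOfLiesOver K (ringClassField K ι ℓ) v w').toAlgebra;
      transverseSubgroup (GaloisRep.toLocal v ((W.baseChange K).torsionGaloisModule ((2 ^ k : ℕ) : ℤ)))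
        (w'.adicCompletion (ringClassField K ι ℓ)))) :
    (weilContPairingLocal (W.baseChange K) (2 ^ k) e hμ hadd₁ hadd₂ hgal (Sum.inr v)).cupProduct a b = 0 := by
  haveI : CompactSpace (absoluteGaloisGroup (v.adicCompletion K)) :=
    ‹CompactSpace (absoluteGaloisGroup (Place.Completion (Sum.inr v : Place K)))›
  letI := (adicCompletionOfLiesOver K (ringClassField K ι ℓ) v w').toAlgebra
  have hℓp : ℓ.Prime := hℓ.1
  have hℓP : (Ideal.span {(ℓ : 𝓞 K)}).IsPrime := hℓ.2.2.2.2.1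
  have hℓ0 : ℓ ≠ 0 := hℓp.ne_zero
  haveI := (finiteDimensional_and_isGalois_ringClassField hK ι hℓ0).1
  let e₀ : ringClassField K ι ℓ →ₐ[K] AlgebraicClosure K := IsAlgClosed.lift
  obtain ⟨Φ, hker, hΦI, hsurj, hcyc, hcard⟩ := exists_ringClassCharacter K hK hD ι hℓp hℓP v hv e₀
  have hI := toLocal_apply_eq_of_mem_absInertia W K Nat.prime_two hℓ v hv k
  -- a preimage `σ` of a generator of `G_ℓ`, of order `ℓ + 1`
  haveI : Finite (ringClassGalOver ι ℓ 1) := Nat.finite_of_card_ne_zero (by rw [hcard]; exact Nat.succ_ne_zero ℓ)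
  obtain ⟨g₀, hg₀⟩ := IsCyclic.exists_monoid_generator (α := ringClassGalOver ι ℓ 1)
  obtain ⟨σ, hσ⟩ := hsurj g₀
  have htop : Subgroup.zpowers g₀ = ⊤ := by
    rw [eq_top_iff]
    exact fun x _ ↦ mem_powers_iff_mem_zpowers.mp (hg₀ x)
  have hord : orderOf (Φ σ) = ℓ + 1 := by
    rw [hσ, ← Nat.card_zpowers, htop, Subgroup.card_top, hcard]
  -- the fibres of `Φ` are open: `ker Φ` is closed of finite index
  have hHset : ((Φ.ker : Subgroup _) : Set (absoluteGaloisGroup (v.adicCompletion K))) =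
      Set.range (absGaloisRestrict (v.adicCompletion K) (w'.adicCompletion (ringClassField K ι ℓ))) := by
    ext d
    rw [SetLike.mem_coe, MonoidHom.mem_ker]
    exact ringClassCharacter_eq_one_iff_mem_range K hK ι hℓ0 v e₀ Φ hker w' d
  haveI : CharZero (w'.adicCompletion (ringClassField K ι ℓ)) := charZero_adicCompletion w'
  have hclosed : IsClosed ((Φ.ker : Subgroup _) : Set (absoluteGaloisGroup (v.adicCompletion K))) := by
    rw [hHset]; exact isClosed_range_absGaloisRestrict _ _
  haveI : Finite (absoluteGaloisGroup (v.adicCompletion K) ⧸ Φ.ker) :=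
    Finite.of_equiv _ (QuotientGroup.quotientKerEquivOfSurjective Φ hsurj).toEquiv.symm
  haveI : Φ.ker.FiniteIndex := Subgroup.finiteIndex_of_finite_quotient
  have hopen : IsOpen ((Φ.ker : Subgroup _) : Set (absoluteGaloisGroup (v.adicCompletion K))) :=
    Subgroup.isOpen_of_isClosed_of_finiteIndex Φ.ker hclosed
  have hχ : ∀ x₀, IsOpen {x : absoluteGaloisGroup (v.adicCompletion K) | Φ x = Φ x₀} := by
    intro x₀
    have hset : {x : absoluteGaloisGroup (v.adicCompletion K) | Φ x = Φ x₀} =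
        (fun x ↦ x₀⁻¹ * x) ⁻¹' ((Φ.ker : Subgroup _) : Set (absoluteGaloisGroup (v.adicCompletion K))) := by
      ext x
      simp only [Set.mem_setOf_eq, Set.mem_preimage, SetLike.mem_coe, MonoidHom.mem_ker, map_mul, map_inv,
        inv_mul_eq_one]
      exact eq_comm
    rw [hset]
    exact hopen.preimage (continuous_const.mul continuous_id)
  refine TransverseCupEven.cupProduct_eq_zero_of_principal_of_cyclic_even _ Φ hχ a b (fun x ↦ ?_) (fun y ↦ ?_)
    (fun s x hx ↦ ?_) (fun s y hy ↦ ?_) (fun f hf ↦ ?_) (fun g hg ↦ ?_) σ (fun s ↦ ?_) (fun z ↦ ?_)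
  · exact (GaloisRep.toLocal v ((W.baseChange K).torsionGaloisModule ((2 ^ k : ℕ) : ℤ))).continuous_apply_left x
  · exact (GaloisRep.toLocal v ((W.baseChange K).torsionGaloisModule ((2 ^ k : ℕ) : ℤ))).continuous_apply_left y
  · exact apply_eq_self_of_forall_ker_of_inertia
      (GaloisRep.toLocal v ((W.baseChange K).torsionGaloisModule ((2 ^ k : ℕ) : ℤ))) Φ hI hΦI s x hx
  · exact apply_eq_self_of_forall_ker_of_inertia
      (GaloisRep.toLocal v ((W.baseChange K).torsionGaloisModule ((2 ^ k : ℕ) : ℤ))) Φ hI hΦI s y hy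
  · rw [← hf] at ha
    obtain ⟨x, hx⟩ := (mem_transverseSubgroup_iff_exists_forall_range
      (GaloisRep.toLocal v ((W.baseChange K).torsionGaloisModule ((2 ^ k : ℕ) : ℤ))) _ f).1 ha
    exact ⟨x, fun h hh ↦ hx h ((ringClassCharacter_eq_one_iff_mem_range K hK ι hℓ0 v e₀ Φ hker w' h).1 hh)⟩
  · rw [← hg] at hb
    obtain ⟨y, hy⟩ := (mem_transverseSubgroup_iff_exists_forall_range
      (GaloisRep.toLocal v ((W.baseChange K).torsionGaloisModule ((2 ^ k : ℕ) : ℤ))) _ g).1 hb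
    exact ⟨y, fun h hh ↦ hy h ((ringClassCharacter_eq_one_iff_mem_range K hK ι hℓ0 v e₀ Φ hker w' h).1 hh)⟩
  · -- the image `G_ℓ` is generated by `Φ σ = g₀`
    obtain ⟨i, hi⟩ := (Submonoid.mem_powers_iff _ _).mp (hg₀ (Φ s))
    exact ⟨i, by rw [hσ, hi]⟩
  · -- `binom(ℓ + 1, 2) • μ_{2^k} = 0` since `2^{k+1} ∣ ℓ + 1` (margin one)
    obtain ⟨m, hm⟩ := (Zhang2014.le_kolyvaginIndex_iff.mp hkℓ).1
    have h2k : (2 ^ k) • z = 0 := by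
      rw [← natCast_zsmul]
      exact zsmul_muCarrier_eq_zero K (2 ^ k) z
    have hchoose : (ℓ + 1).choose 2 = (m * ℓ) * 2 ^ k := by
      rw [Nat.choose_two_right, Nat.add_sub_cancel, hm, show 2 ^ (k + 1) * m * ℓ = (m * ℓ * 2 ^ k) * 2 by ring,
        Nat.mul_div_cancel _ two_pos]
    rw [hord, hchoose, mul_smul, h2k, smul_zero]

/-- **LAGRANGIAN at `2`: `Tr^⊥ = Tr`** for `Tr = H¹_tr(K_λ, E[2^k])` at a Kolyvagin prime of index `≥ k + 1`
(isotropy above + the count `#Tr^⊥ · #Tr = #H¹`, `#Tr = #E(K_λ)[2^k]`, exactly as at odd `p`).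
[cite: Howard2004HeegnerKolyvagin, Prop. 2.1.9 (ii)] [cite: MilneADT2006, Ch. I, Thm. 2.8] -/
theorem annRight_invWeilPairing_transverseSubgroup_ringClassField_eq_two (hK : IsImaginaryQuadratic K)
    (hD : NumberField.discr K < -4) (ι : K →+* ℂ) [∀ j : ℕ, NumberField (ringClassField K ι j)]
    {k : ℕ} (hk : 1 ≤ k) [NeZero (2 ^ k)]
    {ℓ : ℕ} (hℓ : Zhang2014.IsKolyvaginPrime (W.conductorNorm ℤ) W K 2 ℓ)
    (hkℓ : k + 1 ≤ Zhang2014.kolyvaginIndex W 2 ℓ)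
    (v : HeightOneSpectrum (𝓞 K)) (hv : (ℓ : 𝓞 K) ∈ v.asIdeal)
    (w' : HeightOneSpectrum (𝓞 (ringClassField K ι ℓ))) [w'.asIdeal.LiesOver v.asIdeal]
    (e : geomTorsion (W.baseChange K) ((2 ^ k : ℕ) : ℤ) → geomTorsion (W.baseChange K) ((2 ^ k : ℕ) : ℤ) →
      AlgebraicClosure K)
    (hμ : ∀ S T, e S T ^ (2 ^ k) = 1)
    (hadd₁ : ∀ S₁ S₂ T, e (S₁ + S₂) T = e S₁ T * e S₂ T)
    (hadd₂ : ∀ S T₁ T₂, e S (T₁ + T₂) = e S T₁ * e S T₂)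
    (hgal : ∀ (g : absoluteGaloisGroup K) (S T : geomTorsion (W.baseChange K) ((2 ^ k : ℕ) : ℤ)),
      g • e S T = e (g • S) (g • T))
    (hnondeg : ∀ T, (∀ S, e S T = 1) → T = 0)
    (inv : LocalInvariants K (2 ^ k)) (hinv : Injective (inv (Sum.inr v))) :
    annRight (X11b.Relaxation.invWeilPairing (W.baseChange K) (2 ^ k) e hμ hadd₁ hadd₂ hgal inv (Sum.inr v))
        (letI := (adicCompletionOfLiesOver K (ringClassField K ι ℓ) v w').toAlgebra;
          transverseSubgroup (GaloisRep.toLocal v ((W.baseChange K).torsionGaloisModule ((2 ^ k : ℕ) : ℤ)))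
            (w'.adicCompletion (ringClassField K ι ℓ))) =
      (letI := (adicCompletionOfLiesOver K (ringClassField K ι ℓ) v w').toAlgebra;
        transverseSubgroup (GaloisRep.toLocal v ((W.baseChange K).torsionGaloisModule ((2 ^ k : ℕ) : ℤ)))
          (w'.adicCompletion (ringClassField K ι ℓ))) := by
  letI := (adicCompletionOfLiesOver K (ringClassField K ι ℓ) v w').toAlgebra
  haveI : CharZero (v.adicCompletion K) := charZero_adicCompletion v
  haveI : Finite (geomTorsion (W.baseChange K) ((2 ^ k : ℕ) : ℤ)) :=
    finite_geomTorsion_of_neZero (W.baseChange K) (2 ^ k)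
  haveI : CompactSpace (absoluteGaloisGroup (Place.Completion (Sum.inr v : Place K))) :=
    absoluteGaloisGroup_compactSpace _
  have hℓp : ℓ.Prime := hℓ.1
  -- `λ ∤ p`
  have hpv : ((2 : ℕ) : 𝓞 K) ∉ v.asIdeal := by
    have h := (hasGoodReductionAt_of_zhangKolyvagin W K Nat.prime_two hℓ v hv 1).2
    rwa [pow_one, Int.cast_natCast] at h
  set b := X11b.Relaxation.invWeilPairing (W.baseChange K) (2 ^ k) e hμ hadd₁ hadd₂ hgal inv (Sum.inr v) with hb
  set L := transverseSubgroup (GaloisRep.toLocal v ((W.baseChange K).torsionGaloisModule ((2 ^ k : ℕ) : ℤ)))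
    (w'.adicCompletion (ringClassField K ι ℓ)) with hL
  haveI hfinA : Finite (galoisCohomology
      (((W.baseChange K).torsionGaloisModule ((2 ^ k : ℕ) : ℤ)).toLocal (Sum.inr v : Place K)) 1) := by
    change Finite (galoisCohomology (GaloisRep.restrictField (v.adicCompletion K)
      ((W.baseChange K).torsionGaloisModule ((2 ^ k : ℕ) : ℤ))) 1)
    exact finite_galoisCohomology_one_of_isNonarchimedeanLocalField _
  haveI hfinB : Finite (galoisCohomology
      (GaloisRep.toLocal v ((W.baseChange K).torsionGaloisModule ((2 ^ k : ℕ) : ℤ))) 1) :=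
    finite_galoisCohomology_one_of_isNonarchimedeanLocalField _
  have hA : ∀ x : galoisCohomology
      (((W.baseChange K).torsionGaloisModule ((2 ^ k : ℕ) : ℤ)).toLocal (Sum.inr v : Place K)) 1, (2 ^ k) • x = 0 :=
    nsmul_continuousCohomology_one_eq_zero _ (2 ^ k)
      (fun T : geomTorsion (W.baseChange K) ((2 ^ k : ℕ) : ℤ) ↦ AddSubgroup.torsionBy.nsmul T)
  haveI := finite_addMonoidHom_zmod (galoisCohomology
    (((W.baseChange K).torsionGaloisModule ((2 ^ k : ℕ) : ℤ)).toLocal (Sum.inr v : Place K)) 1) (2 ^ k)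
  -- (1) isotropy `L ≤ L^⊥` (§1)
  have hle : L ≤ annRight b L := fun y hy x hx ↦ by
    have h0 := weilCupProduct_eq_zero_of_mem_transverseSubgroup_ringClassField_two W K hK hD ι k hℓ hkℓ v hv w'
      e hμ hadd₁ hadd₂ hgal hx hy
    rw [hb, X11b.Relaxation.invWeilPairing_apply]
    exact (congrArg (inv (Sum.inr v)) h0).trans (map_zero _)
  -- (2) the right adjoint is bijective (local Tate duality for `E[p^k]` + `inv_v` injective)
  have hflip : Bijective b.flip := by
    have hinj : Injective b.flip := by
      intro y y' h
      rw [← sub_eq_zero]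
      refine eq_zero_of_forall_weilCupProduct_eq_zero_right_inr (W.baseChange K) (2 ^ k) e hμ hadd₁ hadd₂ v hgal
        hnondeg _ fun x ↦ ?_
      have h1 : b x (y - y') = 0 := by
        rw [map_sub, sub_eq_zero]
        exact DFunLike.congr_fun h x
      rw [hb, X11b.Relaxation.invWeilPairing_apply] at h1
      exact hinv (h1.trans (map_zero _).symm)
    exact hinj.bijective_of_nat_card_le (Nat.card_addMonoidHom_zmod hA).le
  have hNL : Nat.card (annRight b L) * Nat.card L =
      Nat.card (galoisCohomology (((W.baseChange K).torsionGaloisModule ((2 ^ k : ℕ) : ℤ)).toLocal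
        (Sum.inr v : Place K)) 1) :=
    natCard_annRight_mul hA b hflip L
  -- (3) the counts: `#H¹ = #E(K_v)[p^k]²` (Milne I 2.8) and `#L = #E(K_v)[p^k]` (§2)
  have hH1 : Nat.card (galoisCohomology (((W.baseChange K).torsionGaloisModule ((2 ^ k : ℕ) : ℤ)).toLocal
        (Sum.inr v : Place K)) 1) =
      Nat.card (nsmulAddMonoidHom (2 ^ k) :
        ((W.baseChange K).baseChange (v.adicCompletion K)).toAffine.Point →+ _).ker ^ 2 := by
    have h := natCard_galoisCohomology_one_torsion_adicCompletion_eq_sq_of_not_mem (W.baseChange K) v 2 hpv (k - 1)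
    rw [Nat.sub_add_cancel hk] at h
    exact h
  have hLc : Nat.card L = Nat.card (nsmulAddMonoidHom (2 ^ k) :
      ((W.baseChange K).baseChange (v.adicCompletion K)).toAffine.Point →+ _).ker :=
    natCard_transverseSubgroup_ringClassField_eq W K hK hD ι k hℓ (Nat.le_of_succ_le hkℓ) v hv w'
  have hLpos : 0 < Nat.card L := Nat.card_pos
  have hann : Nat.card (annRight b L) ≤ Nat.card L := by
    have h2 : Nat.card (annRight b L) * Nat.card L = Nat.card L * Nat.card L := by
      rw [hNL, hH1, hLc, sq]
    exact (Nat.eq_of_mul_eq_mul_right hLpos h2).le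
  exact (AddSubgroup.eq_of_le_of_card_ge hle hann).symm

/-- **The ring-class transverse family is SELF-DUAL at the places of a square-free product of Kolyvagin primes
of index `≥ k + 1`, `p = 2`** — the binder `h𝒯sd` of the S1 composition for this family.
[cite: Howard2004HeegnerKolyvagin, Prop. 2.1.9 (ii)] [cite: Jetchev2008, §3.1.2 (p. 814)] -/
theorem dualTransported_eq_of_localTransverseFamily_two (hK : IsImaginaryQuadratic K)
    (hD : NumberField.discr K < -4) (ι : K →+* ℂ) [∀ j : ℕ, NumberField (ringClassField K ι j)]
    (k : ℕ) (hk : 1 ≤ k) [NeZero (2 ^ k)]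
    [Finite (geomTorsion (W.baseChange K) ((2 ^ k : ℕ) : ℤ))]
    (c : ℕ) (hc : Squarefree c)
    (hkol : ∀ ℓ ∈ c.primeFactors, Zhang2014.IsKolyvaginPrime (W.conductorNorm ℤ) W K 2 ℓ)
    (hkM : ∀ ℓ ∈ c.primeFactors, k + 1 ≤ Zhang2014.kolyvaginIndex W 2 ℓ)
    (𝒯 : SelmerStructure ((W.baseChange K).torsionGaloisModule ((2 ^ k : ℕ) : ℤ)))
    (h𝒯 : ∀ v : HeightOneSpectrum (𝓞 K), 𝒯 (Sum.inr v) =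
      ⨅ ℓ ∈ c.primeFactors.filter (fun ℓ : ℕ ↦ ((ℓ : ℕ) : 𝓞 K) ∈ v.asIdeal),
        ⨅ (w' : HeightOneSpectrum (𝓞 (ringClassField K ι ℓ))) (_ : w'.asIdeal.LiesOver v.asIdeal),
          letI := (adicCompletionOfLiesOver K (ringClassField K ι ℓ) v w').toAlgebra
          transverseSubgroup (GaloisRep.toLocal v ((W.baseChange K).torsionGaloisModule ((2 ^ k : ℕ) : ℤ)))
            (w'.adicCompletion (ringClassField K ι ℓ)))
    (e : geomTorsion (W.baseChange K) ((2 ^ k : ℕ) : ℤ) → geomTorsion (W.baseChange K) ((2 ^ k : ℕ) : ℤ) →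
      AlgebraicClosure K)
    (hμ : ∀ S T, e S T ^ (2 ^ k) = 1)
    (hadd₁ : ∀ S₁ S₂ T, e (S₁ + S₂) T = e S₁ T * e S₂ T)
    (hadd₂ : ∀ S T₁ T₂, e S (T₁ + T₂) = e S T₁ * e S T₂)
    (hgal : ∀ (g : absoluteGaloisGroup K) (S T : geomTorsion (W.baseChange K) ((2 ^ k : ℕ) : ℤ)),
      g • e S T = e (g • S) (g • T))
    (_halt : ∀ T, e T T = 1) (hnondeg : ∀ T, (∀ S, e S T = 1) → T = 0)
    (inv : LocalInvariants K (2 ^ k)) (hperf : inv.IsPerfect)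
    (v : HeightOneSpectrum (𝓞 K)) (hvc : v ∈ placesDividing K c) :
    inv.dualTransported 𝒯 (weilDualIntertwining (W.baseChange K) (2 ^ k) e hμ hadd₁ hadd₂ hgal) (Sum.inr v) =
      𝒯 (Sum.inr v) := by
  have hc0 : c ≠ 0 := hc.ne_zero
  -- the prime `ℓ₀ ∣ c` under `v`, unique
  obtain ⟨ℓ₀, hℓ₀c, hℓ₀v⟩ := (natCast_mem_iff_exists_primeFactor_mem hc0 v).mp
    ((mem_placesDividing_iff_natCast_mem hc0 v).mp hvc)
  have hℓ₀ := hkol ℓ₀ hℓ₀c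
  have hℓ₀p : ℓ₀.Prime := hℓ₀.1
  have hℓ₀0 : ℓ₀ ≠ 0 := hℓ₀p.ne_zero
  have huniq : ∀ ℓ ∈ c.primeFactors, ((ℓ : ℕ) : 𝓞 K) ∈ v.asIdeal → ℓ = ℓ₀ := by
    intro ℓ hℓc hℓv
    by_contra hne
    have hcop : Nat.Coprime ℓ₀ ℓ :=
      (Nat.coprime_primes hℓ₀p (Nat.prime_of_mem_primeFactors hℓc)).mpr (Ne.symm hne)
    exact X11b.Three.Koly.Method2.not_mem_asIdeal_of_coprime K hcop v hℓ₀v hℓv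
  -- a place `w₀ ∣ v` of `K[ℓ₀]`
  haveI := (finiteDimensional_and_isGalois_ringClassField hK ι hℓ₀0).2
  obtain ⟨w₀⟩ := (inferInstance : Nonempty (SemiLocal.Place K (ringClassField K ι ℓ₀) v))
  haveI hw₀ : (w₀ : HeightOneSpectrum (𝓞 (ringClassField K ι ℓ₀))).asIdeal.LiesOver v.asIdeal :=
    SemiLocal.Place.liesOver w₀
  letI := (adicCompletionOfLiesOver K (ringClassField K ι ℓ₀) v (w₀ : HeightOneSpectrum (𝓞 (ringClassField K ι ℓ₀)))).toAlgebra
  -- `𝒯_v` is the transverse subgroup at `w₀`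
  have h𝒯v : 𝒯 (Sum.inr v) =
      transverseSubgroup (GaloisRep.toLocal v ((W.baseChange K).torsionGaloisModule ((2 ^ k : ℕ) : ℤ)))
        ((w₀ : HeightOneSpectrum (𝓞 (ringClassField K ι ℓ₀))).adicCompletion (ringClassField K ι ℓ₀)) := by
    rw [h𝒯 v]
    ext y
    simp only [AddSubgroup.mem_iInf, Finset.mem_filter, and_imp]
    constructor
    · intro H
      exact H ℓ₀ hℓ₀c hℓ₀v (w₀ : HeightOneSpectrum (𝓞 (ringClassField K ι ℓ₀))) hw₀
    · intro hy ℓ hℓc hℓv w' hw'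
      obtain rfl := huniq ℓ hℓc hℓv
      rw [transverseSubgroup_adicCompletion_eq_of_liesOver
        ((W.baseChange K).torsionGaloisModule ((2 ^ k : ℕ) : ℤ)) (ringClassField K ι ℓ) v w'
        (w₀ : HeightOneSpectrum (𝓞 (ringClassField K ι ℓ)))]
      exact hy
  rw [X5.SelfDualCount.dualTransported_weilDual_eq_annRight (W.baseChange K) (2 ^ k) e hμ hadd₁ hadd₂ hgal inv 𝒯
    (Sum.inr v), h𝒯v]
  exact annRight_invWeilPairing_transverseSubgroup_ringClassField_eq_two W K hK hD ι hk hℓ₀ (hkM ℓ₀ hℓ₀c) v hℓ₀v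
    (w₀ : HeightOneSpectrum (𝓞 (ringClassField K ι ℓ₀))) e hμ hadd₁ hadd₂ hgal hnondeg inv (hperf v).1.injective

end Summit.BirchSwinnertonDyer.BirchSwinnertonDyer.Theorems.KolyvaginLowerBoundAtTwo

end
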